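import Mathlib
import HarnessLib
import Summits.ResolutionOfSingularities.ResolutionOfSingularities.Theorems.WildQuotientsWildQuotientResolutionS1aTriangularShiftKillsIn

/-!
# S1a — THE FEEDBACK-TAIL FAMILY `x₁ ↦ x₁ + x₀, x₂ ↦ x₂ + x₁^d + x₀·H` is a ONE-SHOT root kill (every `d ≥ 1`, every `H`, every prime `p`)

[OURS · L1 W4.5c · leafhand-res-wildquotients-9 g1; corollary of ✓`triangularShift_killsIn_one` (`…S1aTriangularShiftKillsIn`); SUCCESSOR-BRIEF-v2
ADDENDUM v2d («the feedback germ σ = (x₀, x₁+x₀, x₂+x₁², x₃) (p ≥ 5; ONE member (3,1;2))», class taxonomy `r = 1` FEEDBACK TAILS, programme R6)] —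
NOT statements of the manuscript; counted 0; AI-level work, weaker than expert review. Crux stmt-ResolutionOfSingularities-17941 `CyclicQuotientFourfolds`,
line `s1a-logminvertex` v13 (`stub_reachLowerInFX`). A FAMILY OF RUNGS of the research stub, not the stub.

A FEEDBACK tail is one whose translated variable feeds on a MOVING variable (`x₂ ↦ x₂ + T(x₁)` with `x₁ ↦ x₁ + x₀`), as opposed to the
`x₃`-tails over invariant arguments of R4. The simplest family is one-shot, uniformly:
* ★ `feedbackTail_killsIn_one` — σ: `x₀ ↦ x₀`, `x₁ ↦ x₁ + x₀`, `x₂ ↦ x₂ + x₁^d + x₀·H` (ANY `d ≥ 1`, ANY `H ∈ k[x₀,…,x₃]`), `x₃ ↦ x₃`: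
  centre `(x₀ : d+1, x₁ : 1)`, shift `δ = d`, power chains `x₀ = σx₁ − x₁` (`m = 1`, `u = x₁ ∈ 𝒥₁`) and `x₁^d ≡ σx₂ − x₂ mod 𝒥_{d+1}`
  (`m = d`, `u = x₂ ∈ 𝒥₀`), isolation `(x₀, x₁)^N ≤ (x₀, x₁^d + x₀H) = augIdeal σ` ⇒ `KillsIn 1 (initial)`; the brief's feedback germ is
  `d = 2`, `H = 0` (and k2a ✓`k2a_killsIn_one` is `d = 2`, `H = x₁` up to renaming `x₂ ↔ x₃`);
* `exists_reachLowerF_initial_of_feedbackTail` — hence the family inhabits the research stub (every root decoration).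
Datum remark: with `H = 0` the order-`p` hypothesis `g₀ ^ p = 1` on the census germ holds iff `d < p − 1` (the coefficients `Σ_{i<p} i^j`,
`1 ≤ j ≤ d`, vanish mod `p` iff `(p−1) ∤ j`); the kill theorem itself is stated for every `p`.
So the R6 stratum's FIRST genuinely multi-shot members must couple the feedback with a second moving direction or a non-monomial leading form
in `x₁` over a moving `x₀`-coefficient — recorded for the line's census, not claimed.
-/

set_option linter.dupNamespace false

noncomputable section

open CategoryTheory Limits AlgebraicGeometry TopologicalSpace Topology Opposite MvPolynomial
open Literature.AlgebraicGeometry.Resolution Literature.AlgebraicGeometry.RelativeSpec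
open Summit.ResolutionOfSingularities.ResolutionOfSingularities.Theorems.WildQuotientResolution.S1
open Summit.ResolutionOfSingularities.ResolutionOfSingularities.Theorems.WildQuotientResolution.S1.NodeAtlas
open Summit.ResolutionOfSingularities.ResolutionOfSingularities.Theorems.WildQuotientResolution.S1.KillCert
open Summit.ResolutionOfSingularities.ResolutionOfSingularities.Theorems.WildQuotientResolution.S1.GoodCharts
open Summit.ResolutionOfSingularities.ResolutionOfSingularities.Theorems.WildQuotientResolution.S1.NpFrame

namespace Summit.ResolutionOfSingularities.ResolutionOfSingularities.Theorems.WildQuotientResolution.S1.GameFrame.GModel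

open KillCert

variable {p : ℕ} {X' X₁ : Scheme.{0}} {q : X' ⟶ X₁} {G : Type} [Group G] {ρ : G →* Aut X'} {g₀ : G}

/-- ★ **THE FEEDBACK-TAIL FAMILY IS A ONE-SHOT KILL** (σ: x₁ ↦ x₁+x₀, x₂ ↦ x₂ + x₁^d + x₀·H, x₀, x₃ fixed; any `d ≥ 1`, any `H`): centre
`(x₀ : d+1, x₁ : 1)`, `δ = d`, power chains `x₀ = σx₁ − x₁`, `x₁^d ≡ σx₂ − x₂ mod 𝒥_{d+1}` (`m = d`). Every `p`.
[OURS · L1 W4.5c · one-shot class with shift, R6 feedback stratum; NOT a statement of the manuscript] -/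
theorem feedbackTail_killsIn_one [Finite G] (hp : p.Prime) (hG : ∀ g : G, g ∈ Subgroup.zpowers g₀) (hg₀ : g₀ ^ p = 1)
    (hq : ∀ g : G, (ρ g).hom ≫ q = q) [IsIntegral X'] [IsLocallyNoetherian X'] [X'.IsSeparated] [IsAffine X'] [X₁.IsSeparated] [IsFinite q]
    (hreg : Scheme.IsRegular X') {k' : Type} [Field k'] (φ : X₁ ⟶ Spec (.of k')) [LocallyOfFiniteType φ]
    {k : Type} [Field k] (σ : MvPolynomial (Fin 4) k ≃+* MvPolynomial (Fin 4) k) (hC : ∀ a : k, σ (C a) = C a)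
    (d : ℕ) (hd : 1 ≤ d) (H : MvPolynomial (Fin 4) k)
    (h0 : σ (X 0) = X 0) (h1 : σ (X 1) = X 1 + X 0) (h2 : σ (X 2) = X 2 + X 1 ^ d + X 0 * H) (h3 : σ (X 3) = X 3)
    (e : Γ(X', ⊤) ≃+* MvPolynomial (Fin 4) k)
    (hστ : ∀ t : Γ(X', ⊤), e ((ρ g₀⁻¹).hom.appLE ⊤ ⊤ (by rw [Scheme.Hom.preimage_top]) t) = σ (e t))
    (h₀ : NodeAtlas p (⟨ρ, hq⟩ : ActionOver q G) g₀) :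
    KillsIn 1 (GModel.initial (p := p) (g₀ := g₀) hq h₀) := by
  let v : Fin 2 → Fin 4 := ![0, 1]
  let w : Fin 2 → ℕ := ![d + 1, 1]
  have hv : Function.Injective v := by decide
  have hw0 : w 0 = d + 1 := rfl
  have hw1 : w 1 = 1 := rfl
  have hX0 : (X 0 : MvPolynomial (Fin 4) k) ∈ (weightedFiltration (X ∘ v : Fin 2 → MvPolynomial (Fin 4) k) w).ideal (d + 1) :=
    mem_weightedFiltration_ideal (X ∘ v : Fin 2 → MvPolynomial (Fin 4) k) w 0
  have hX1 : (X 1 : MvPolynomial (Fin 4) k) ∈ (weightedFiltration (X ∘ v : Fin 2 → MvPolynomial (Fin 4) k) w).ideal 1 :=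
    mem_weightedFiltration_ideal (X ∘ v : Fin 2 → MvPolynomial (Fin 4) k) w 1
  have hX1d : (X 1 : MvPolynomial (Fin 4) k) ^ d ∈ (weightedFiltration (X ∘ v : Fin 2 → MvPolynomial (Fin 4) k) w).ideal d := by
    have := pow_mem_weightedFiltration_ideal (X ∘ v : Fin 2 → MvPolynomial (Fin 4) k) w 1 d
    rwa [hw1, mul_one] at this
  have hX0H : (X 0 : MvPolynomial (Fin 4) k) * H ∈ (weightedFiltration (X ∘ v : Fin 2 → MvPolynomial (Fin 4) k) w).ideal (d + 1) :=
    Ideal.mul_mem_right _ _ hX0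
  have hinc0 : σ (X 0) - X 0 = 0 := by rw [h0, sub_self]
  have hinc1 : σ (X 1) - X 1 = X 0 := by rw [h1]; ring
  have hinc2 : σ (X 2) - X 2 = X 1 ^ d + X 0 * H := by rw [h2]; ring
  have hinc3 : σ (X 3) - X 3 = 0 := by rw [h3, sub_self]
  refine triangularShift_killsIn_one hp hG hg₀ hq hreg φ σ hC (by norm_num : 0 < 2) v hv w
    (fun l => by fin_cases l <;> simp [w]) d ?_ ?_ ?_ ?_ e hστ h₀
  · intro i
    fin_cases i
    · change σ (X 0) - X 0 ∈ _; rw [hinc0]; exact Ideal.zero_mem _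
    · change σ (X 1) - X 1 ∈ _; rw [hinc1]; exact (weightedFiltration _ w).antitone (Nat.le_succ d) hX0
    · change σ (X 2) - X 2 ∈ _; rw [hinc2]; exact add_mem hX1d ((weightedFiltration _ w).antitone (Nat.le_succ d) hX0H)
    · change σ (X 3) - X 3 ∈ _; rw [hinc3]; exact Ideal.zero_mem _
  · intro l
    fin_cases l
    · change σ (X 0) - X 0 ∈ _; rw [hinc0]; exact Ideal.zero_mem _
    · change σ (X 1) - X 1 ∈ (weightedFiltration (X ∘ v : Fin 2 → MvPolynomial (Fin 4) k) w).ideal (1 + d)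
      rw [hinc1, add_comm]; exact hX0
  · refine exists_span_pow_le_of_pow_mem _ _ fun l => ?_
    fin_cases l
    · refine ⟨1, ?_⟩; change (X 0 : MvPolynomial (Fin 4) k) ^ 1 ∈ _
      rw [pow_one, ← hinc1]; exact sub_mem_augmentationIdeal σ _
    · refine ⟨d, ?_⟩; change (X 1 : MvPolynomial (Fin 4) k) ^ d ∈ _
      have e1 : (X 1 : MvPolynomial (Fin 4) k) ^ d = (σ (X 2) - X 2) - H * (σ (X 1) - X 1) := by rw [hinc2, hinc1]; ring
      rw [e1]
      exact sub_mem (sub_mem_augmentationIdeal σ _) (Ideal.mul_mem_left _ _ (sub_mem_augmentationIdeal σ _))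
  · intro l
    fin_cases l
    · refine ⟨1, X 1, 1, one_pos, ?_, isUnit_one, ?_, ?_⟩
      · change d ≤ 1 * (d + 1); omega
      · change (X 1 : MvPolynomial (Fin 4) k) ∈ (weightedFiltration (X ∘ v : Fin 2 → MvPolynomial (Fin 4) k) w).ideal (1 * (d + 1) - d)
        rw [one_mul, Nat.add_sub_cancel_left]; exact hX1
      · change σ (X 1) - X 1 - 1 * X 0 ^ 1 ∈ _
        have e0 : σ (X 1) - X 1 - 1 * X 0 ^ 1 = 0 := by rw [hinc1]; ring
        rw [e0]; exact Ideal.zero_mem _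
    · refine ⟨d, X 2, 1, hd, ?_, isUnit_one, ?_, ?_⟩
      · change d ≤ d * 1; rw [mul_one]
      · change (X 2 : MvPolynomial (Fin 4) k) ∈ (weightedFiltration (X ∘ v : Fin 2 → MvPolynomial (Fin 4) k) w).ideal (d * 1 - d)
        rw [mul_one, Nat.sub_self]; exact mem_weightedFiltration_zero _ w _
      · change σ (X 2) - X 2 - 1 * X 1 ^ d ∈ (weightedFiltration (X ∘ v : Fin 2 → MvPolynomial (Fin 4) k) w).ideal (d * 1 + 1)
        have e1 : σ (X 2) - X 2 - 1 * X 1 ^ d = X 0 * H := by rw [hinc2]; ring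
        rw [e1, mul_one]; exact hX0H

/-- **The feedback-tail family satisfies the conclusion of `ReachLowerInF(X)`** at its initial model with ANY root decoration `𝔄₀`
(`exists_reachLowerF_of_killsIn_datum` on `feedbackTail_killsIn_one`). [OURS · L1 W4.5c · R6 feedback stratum; NOT a statement of the manuscript] -/
theorem exists_reachLowerF_initial_of_feedbackTail [Finite G] (hp : p.Prime) (hG : ∀ g : G, g ∈ Subgroup.zpowers g₀) (hg₀ : g₀ ^ p = 1)
    (hq : ∀ g : G, (ρ g).hom ≫ q = q) [IsIntegral X'] [IsLocallyNoetherian X'] [X'.IsSeparated] [IsAffine X'] [X₁.IsSeparated] [IsFinite q]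
    (hreg : Scheme.IsRegular X') {k' : Type} [Field k'] (φ : X₁ ⟶ Spec (.of k')) [LocallyOfFiniteType φ]
    {k : Type} [Field k] (σ : MvPolynomial (Fin 4) k ≃+* MvPolynomial (Fin 4) k) (hC : ∀ a : k, σ (C a) = C a)
    (d : ℕ) (hd : 1 ≤ d) (H : MvPolynomial (Fin 4) k)
    (h0 : σ (X 0) = X 0) (h1 : σ (X 1) = X 1 + X 0) (h2 : σ (X 2) = X 2 + X 1 ^ d + X 0 * H) (h3 : σ (X 3) = X 3)
    (e : Γ(X', ⊤) ≃+* MvPolynomial (Fin 4) k)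
    (hστ : ∀ t : Γ(X', ⊤), e ((ρ g₀⁻¹).hom.appLE ⊤ ⊤ (by rw [Scheme.Hom.preimage_top]) t) = σ (e t))
    (h₀ : NodeAtlas p (⟨ρ, hq⟩ : ActionOver q G) g₀) (𝔄₀ : NodeAtlasData p (GModel.initial hq h₀).act g₀) :
    ∃ P : ∀ M : GModel p q G ρ g₀, NodeAtlasData p M.act g₀ → Prop,
      P (GModel.initial hq h₀) 𝔄₀ ∧ ∀ (M : GModel p q G ρ g₀) (𝔄 : NodeAtlasData p M.act g₀), P M 𝔄 → ¬ M.Terminal →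
        ∃ n : ℕ, TreeF P (fun N 𝔅 => LexLTF N 𝔅 M 𝔄) n M 𝔄 :=
  exists_reachLowerF_of_killsIn_datum hp hG φ (GModel.initial hq h₀) 𝔄₀
    (feedbackTail_killsIn_one hp hG hg₀ hq hreg φ σ hC d hd H h0 h1 h2 h3 e hστ h₀)

/-! ## Appendix (leafhand-res-wildquotients-9 g1, same session): FEEDBACK CHAINS OF LENGTH 3 are one-shot too

σ = (x₀, x₁ + x₀, x₂ + x₁^a, x₃ + x₂^b): every variable feeds on the previous one. Still ONE weighted move: centre `(x₀ : 1+b+ab, x₁ : 1+b, x₂ : a)`,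
shift `δ = ab`, chains `x₀ = σx₁ − x₁` (`u = x₁ ∈ 𝒥_{1+b}`, `m = 1`), `x₁^a = σx₂ − x₂` (`u = x₂ ∈ 𝒥_a`, `m = a`), `x₂^b = σx₃ − x₃` (`u = x₃ ∈ 𝒥₀`,
`m = b`), all residues `0`, isolation `(x₀,x₁,x₂)^N ≤ (x₀, x₁^a, x₂^b) = augIdeal σ`. (E.g. `a = b = 2`: centre `(7, 3, 2)`, `δ = 4`.) So feedback
DEPTH is not the difficulty of the R6 stratum either. -/

/-- ★ **FEEDBACK CHAINS OF LENGTH 3 ARE ONE-SHOT KILLS** (σ: x₁ ↦ x₁+x₀, x₂ ↦ x₂+x₁^a, x₃ ↦ x₃+x₂^b, x₀ fixed; `a, b ≥ 1`): centre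
`(x₀ : 1+b+ab, x₁ : 1+b, x₂ : a)`, `δ = ab`. Every `p`. [OURS · L1 W4.5c · one-shot class with shift, R6 feedback stratum; NOT a statement of the manuscript] -/
theorem feedbackChain_killsIn_one [Finite G] (hp : p.Prime) (hG : ∀ g : G, g ∈ Subgroup.zpowers g₀) (hg₀ : g₀ ^ p = 1)
    (hq : ∀ g : G, (ρ g).hom ≫ q = q) [IsIntegral X'] [IsLocallyNoetherian X'] [X'.IsSeparated] [IsAffine X'] [X₁.IsSeparated] [IsFinite q]
    (hreg : Scheme.IsRegular X') {k' : Type} [Field k'] (φ : X₁ ⟶ Spec (.of k')) [LocallyOfFiniteType φ]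
    {k : Type} [Field k] (σ : MvPolynomial (Fin 4) k ≃+* MvPolynomial (Fin 4) k) (hC : ∀ a : k, σ (C a) = C a)
    (a b : ℕ) (ha : 1 ≤ a) (hb : 1 ≤ b)
    (h0 : σ (X 0) = X 0) (h1 : σ (X 1) = X 1 + X 0) (h2 : σ (X 2) = X 2 + X 1 ^ a) (h3 : σ (X 3) = X 3 + X 2 ^ b)
    (e : Γ(X', ⊤) ≃+* MvPolynomial (Fin 4) k)
    (hστ : ∀ t : Γ(X', ⊤), e ((ρ g₀⁻¹).hom.appLE ⊤ ⊤ (by rw [Scheme.Hom.preimage_top]) t) = σ (e t))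
    (h₀ : NodeAtlas p (⟨ρ, hq⟩ : ActionOver q G) g₀) :
    KillsIn 1 (GModel.initial (p := p) (g₀ := g₀) hq h₀) := by
  let v : Fin 3 → Fin 4 := ![0, 1, 2]
  let w : Fin 3 → ℕ := ![1 + b + a * b, 1 + b, a]
  have hv : Function.Injective v := by decide
  have hw0 : w 0 = 1 + b + a * b := rfl
  have hw1 : w 1 = 1 + b := rfl
  have hw2 : w 2 = a := rfl
  have hX0 : (X 0 : MvPolynomial (Fin 4) k) ∈ (weightedFiltration (X ∘ v : Fin 3 → MvPolynomial (Fin 4) k) w).ideal (1 + b + a * b) :=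
    mem_weightedFiltration_ideal (X ∘ v : Fin 3 → MvPolynomial (Fin 4) k) w 0
  have hX1 : (X 1 : MvPolynomial (Fin 4) k) ∈ (weightedFiltration (X ∘ v : Fin 3 → MvPolynomial (Fin 4) k) w).ideal (1 + b) :=
    mem_weightedFiltration_ideal (X ∘ v : Fin 3 → MvPolynomial (Fin 4) k) w 1
  have hX2 : (X 2 : MvPolynomial (Fin 4) k) ∈ (weightedFiltration (X ∘ v : Fin 3 → MvPolynomial (Fin 4) k) w).ideal a :=
    mem_weightedFiltration_ideal (X ∘ v : Fin 3 → MvPolynomial (Fin 4) k) w 2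
  have hX1a : (X 1 : MvPolynomial (Fin 4) k) ^ a ∈ (weightedFiltration (X ∘ v : Fin 3 → MvPolynomial (Fin 4) k) w).ideal (a * (1 + b)) := by
    have := pow_mem_weightedFiltration_ideal (X ∘ v : Fin 3 → MvPolynomial (Fin 4) k) w 1 a
    rwa [hw1] at this
  have hX2b : (X 2 : MvPolynomial (Fin 4) k) ^ b ∈ (weightedFiltration (X ∘ v : Fin 3 → MvPolynomial (Fin 4) k) w).ideal (a * b) := by
    have := pow_mem_weightedFiltration_ideal (X ∘ v : Fin 3 → MvPolynomial (Fin 4) k) w 2 b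
    rwa [hw2, mul_comm] at this
  have hinc0 : σ (X 0) - X 0 = 0 := by rw [h0, sub_self]
  have hinc1 : σ (X 1) - X 1 = X 0 := by rw [h1]; ring
  have hinc2 : σ (X 2) - X 2 = X 1 ^ a := by rw [h2]; ring
  have hinc3 : σ (X 3) - X 3 = X 2 ^ b := by rw [h3]; ring
  have hab : a * (1 + b) = a + a * b := by ring
  refine triangularShift_killsIn_one hp hG hg₀ hq hreg φ σ hC (by norm_num : 0 < 3) v hv w
    (fun l => by fin_cases l; exacts [by change 0 < 1 + b + a * b; omega, by change 0 < 1 + b; omega, by change 0 < a; omega])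
    (a * b) ?_ ?_ ?_ ?_ e hστ h₀
  · intro i
    fin_cases i
    · change σ (X 0) - X 0 ∈ _; rw [hinc0]; exact Ideal.zero_mem _
    · change σ (X 1) - X 1 ∈ _; rw [hinc1]; exact (weightedFiltration _ w).antitone (by omega) hX0
    · change σ (X 2) - X 2 ∈ _; rw [hinc2]; exact (weightedFiltration _ w).antitone (by rw [hab]; omega) hX1a
    · change σ (X 3) - X 3 ∈ _; rw [hinc3]; exact hX2b
  · intro l
    fin_cases l
    · change σ (X 0) - X 0 ∈ _; rw [hinc0]; exact Ideal.zero_mem _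
    · change σ (X 1) - X 1 ∈ (weightedFiltration (X ∘ v : Fin 3 → MvPolynomial (Fin 4) k) w).ideal (1 + b + a * b)
      rw [hinc1]; exact hX0
    · change σ (X 2) - X 2 ∈ (weightedFiltration (X ∘ v : Fin 3 → MvPolynomial (Fin 4) k) w).ideal (a + a * b)
      rw [hinc2, ← hab]; exact hX1a
  · refine exists_span_pow_le_of_pow_mem _ _ fun l => ?_
    fin_cases l
    · refine ⟨1, ?_⟩; change (X 0 : MvPolynomial (Fin 4) k) ^ 1 ∈ _
      rw [pow_one, ← hinc1]; exact sub_mem_augmentationIdeal σ _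
    · refine ⟨a, ?_⟩; change (X 1 : MvPolynomial (Fin 4) k) ^ a ∈ _
      rw [← hinc2]; exact sub_mem_augmentationIdeal σ _
    · refine ⟨b, ?_⟩; change (X 2 : MvPolynomial (Fin 4) k) ^ b ∈ _
      rw [← hinc3]; exact sub_mem_augmentationIdeal σ _
  · intro l
    fin_cases l
    · refine ⟨1, X 1, 1, one_pos, ?_, isUnit_one, ?_, ?_⟩
      · change a * b ≤ 1 * (1 + b + a * b); omega
      · change (X 1 : MvPolynomial (Fin 4) k) ∈ (weightedFiltration (X ∘ v : Fin 3 → MvPolynomial (Fin 4) k) w).ideal (1 * (1 + b + a * b) - a * b)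
        rw [show 1 * (1 + b + a * b) - a * b = 1 + b by omega]; exact hX1
      · change σ (X 1) - X 1 - 1 * X 0 ^ 1 ∈ _
        have e0 : σ (X 1) - X 1 - 1 * X 0 ^ 1 = 0 := by rw [hinc1]; ring
        rw [e0]; exact Ideal.zero_mem _
    · refine ⟨a, X 2, 1, ha, ?_, isUnit_one, ?_, ?_⟩
      · change a * b ≤ a * (1 + b); rw [hab]; omega
      · change (X 2 : MvPolynomial (Fin 4) k) ∈ (weightedFiltration (X ∘ v : Fin 3 → MvPolynomial (Fin 4) k) w).ideal (a * (1 + b) - a * b)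
        rw [show a * (1 + b) - a * b = a by rw [hab]; omega]; exact hX2
      · change σ (X 2) - X 2 - 1 * X 1 ^ a ∈ _
        have e0 : σ (X 2) - X 2 - 1 * X 1 ^ a = 0 := by rw [hinc2]; ring
        rw [e0]; exact Ideal.zero_mem _
    · refine ⟨b, X 3, 1, hb, ?_, isUnit_one, ?_, ?_⟩
      · change a * b ≤ b * a; rw [mul_comm]
      · change (X 3 : MvPolynomial (Fin 4) k) ∈ (weightedFiltration (X ∘ v : Fin 3 → MvPolynomial (Fin 4) k) w).ideal (b * a - a * b)
        rw [mul_comm, Nat.sub_self]; exact mem_weightedFiltration_zero _ w _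
      · change σ (X 3) - X 3 - 1 * X 2 ^ b ∈ _
        have e0 : σ (X 3) - X 3 - 1 * X 2 ^ b = 0 := by rw [hinc3]; ring
        rw [e0]; exact Ideal.zero_mem _

/-- **Feedback chains inhabit the research stub** (every root decoration). [OURS · L1 W4.5c · R6 feedback stratum; NOT a statement of the manuscript] -/
theorem exists_reachLowerF_initial_of_feedbackChain [Finite G] (hp : p.Prime) (hG : ∀ g : G, g ∈ Subgroup.zpowers g₀) (hg₀ : g₀ ^ p = 1)
    (hq : ∀ g : G, (ρ g).hom ≫ q = q) [IsIntegral X'] [IsLocallyNoetherian X'] [X'.IsSeparated] [IsAffine X'] [X₁.IsSeparated] [IsFinite q]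
    (hreg : Scheme.IsRegular X') {k' : Type} [Field k'] (φ : X₁ ⟶ Spec (.of k')) [LocallyOfFiniteType φ]
    {k : Type} [Field k] (σ : MvPolynomial (Fin 4) k ≃+* MvPolynomial (Fin 4) k) (hC : ∀ a : k, σ (C a) = C a)
    (a b : ℕ) (ha : 1 ≤ a) (hb : 1 ≤ b)
    (h0 : σ (X 0) = X 0) (h1 : σ (X 1) = X 1 + X 0) (h2 : σ (X 2) = X 2 + X 1 ^ a) (h3 : σ (X 3) = X 3 + X 2 ^ b)
    (e : Γ(X', ⊤) ≃+* MvPolynomial (Fin 4) k)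
    (hστ : ∀ t : Γ(X', ⊤), e ((ρ g₀⁻¹).hom.appLE ⊤ ⊤ (by rw [Scheme.Hom.preimage_top]) t) = σ (e t))
    (h₀ : NodeAtlas p (⟨ρ, hq⟩ : ActionOver q G) g₀) (𝔄₀ : NodeAtlasData p (GModel.initial hq h₀).act g₀) :
    ∃ P : ∀ M : GModel p q G ρ g₀, NodeAtlasData p M.act g₀ → Prop,
      P (GModel.initial hq h₀) 𝔄₀ ∧ ∀ (M : GModel p q G ρ g₀) (𝔄 : NodeAtlasData p M.act g₀), P M 𝔄 → ¬ M.Terminal →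
        ∃ n : ℕ, TreeF P (fun N 𝔅 => LexLTF N 𝔅 M 𝔄) n M 𝔄 :=
  exists_reachLowerF_of_killsIn_datum hp hG φ (GModel.initial hq h₀) 𝔄₀
    (feedbackChain_killsIn_one hp hG hg₀ hq hreg φ σ hC a b ha hb h0 h1 h2 h3 e hστ h₀)

end Summit.ResolutionOfSingularities.ResolutionOfSingularities.Theorems.WildQuotientResolution.S1.GameFrame.GModel

end
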